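import Summits.BirchSwinnertonDyer.BirchSwinnertonDyer.Theorems.SylvesterTwoHeegnerIndexUpperHalfContent
import Summits.BirchSwinnertonDyer.BirchSwinnertonDyer.Theorems.SylvesterTwoHeegnerIndexLowerHalfContent
import HarnessLib

/-!
# Route `SylvesterTwoHeegnerIndex` (rung K7t), crux `HeegnerIndexUpperAtTwoHSYOfFacts` (item 19476):
# the UPPER half in HU–SHU–YIN PAIR FORM `(E_p, E_{3p²})` — binder-free content disclosure

HONEST FRAMING (cell «bsd-cm», `run/shared/lean/pub/bsd-cm/`, D-0033 tranche 1a; D-0074 seat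
`bsd-cm-k7t-c2` gen 2; item stmt-BirchSwinnertonDyer-19476 = the facts-conditional twin of 19229,
D82 (a)). The crux — the Kolyvagin direction `ord₂ #Ш(E_p) ≤ ord₂ 𝔮` of `BSD(E_p, 2)` on the Sylvester
family 𝒞_HSY (`E_p : x³ + y³ = p`, `p ≡ 4, 7 (mod 9)` prime, `3 ∉ 𝔽_p^{×3}`), granted the route's
published facts — is OPEN AS A CLASS (B14 = O12) and STAYS OPEN here. This file proves no case of it
at class level; it is BINDER-FREE (only the route's own support item `PublishedFactsTwo`, 19231, and
its named published conjuncts enter, as explicit hypotheses).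

Hu–Shu–Yin's explicit Gross–Zagier formula is a formula for the PRODUCT `L′(1, E_p) · L(1, E_{3p²})`
([HuShuYin2019] Cor. 4.4; display (bsd), p. 12: `|Ш(E_p)|·|Ш(E_{3p²})| = 2^i ĥ(R)/ĥ(P)` as the BSD
prediction), and the tree's family fact `thm14_threePart_product` is typed in exactly that PAIR
currency (`#Ш_an(B) = qB`, `#Ш_an(A) = qA` for globally minimal `B ≅ E_p`, `A ≅ E_{3p²}`, with
`ord₃ (qB·qA) = 0`). We prove that the crux IS the `2`-adic Kolyvagin inequality FOR THE PAIR: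

* `upperOfFacts_iff`, `lowerOfFacts_iff` — the twins unfold BY NAME to `PublishedFactsTwo → half`;
  `upperOfFacts_iff_missingUpperBoundAt` — p418375's content disclosure moved under the antecedent.
* `pair_shaAn_two` — the partner's bookkeeping: `r_an(A) = 0` (Hu–Shu–Yin) ⇒ `L(A,1) ≠ 0`
  (modularity) ⇒ full BSD for the CM curve `A` (Burungale–Flach 2024 / Rubin,
  `bsdTriple_of_hasCM_of_L_one_ne_zero`) ⇒ `ord₂ #Ш_an(A) = ord₂ #Ш(A)[2^∞]`.
* `missingUpperBoundAt_iff_pairBound` / `missingLowerBoundAt_iff_pairBound` — per member: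
  `MissingUpperBoundAt B 2 ⟺ ord₂ #Ш(B)[2^∞] + ord₂ #Ш(A)[2^∞] ≤ ord₂ (#Ш_an(B)·#Ш_an(A))` (and the
  reverse inequality for the lower half): the partner's terms cancel exactly.
* **`upperOfFacts_iff_pairBound`** — `HeegnerIndexUpperAtTwoHSYOfFacts ⟺ (facts → ∀ members, ∀ minimal
  A ≅ E_{3p²}, ord₂ #Ш(E_p)[2^∞] + ord₂ #Ш(E_{3p²})[2^∞] ≤ ord₂ (#Ш_an(E_p)·#Ш_an(E_{3p²})))`; and
  `lowerOfFacts_iff_pairBound` — the same service for the LOWER twin 19477 (hand k7t-c3).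

So the open content of 19476 is a `2`-adic Kolyvagin inequality for Hu–Shu–Yin's Rankin-type product,
whose right side their Cor. 4.4 makes `i + ord₂ (ĥ(R)/ĥ(P))` — the `2`-adic valuation of ONE explicit
Heegner index over `ℚ(√−3)`. The sequel `…UpperOnV0.lean` puts the cell's refereed `2`-adic index
theorem (memo two Thm B′/B″ + C) on top as ONE displayed binder and discharges the planner's `𝒱₀` layer.

WHAT THIS IS NOT: not a proof of the crux for any `p`; not a Kolyvagin argument at `2`; nothing booked,
no label moves. References: [HuShuYin2019] Thm. 1.3/1.4, Cor. 4.4, (bsd) p. 12; [BurungaleFlach2024]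
Thm. 1.1, Cor. 2; [Miller2011LMS] Def. 1.1; [Kolyvagin1990] Thm. A; [GrossZagier1986] I.(6.5);
parents p418375 (`…UpperHalfContent`), p417655 (`…LowerHalfContent`), `X12/CubeSumFamilies.lean`.
-/

set_option autoImplicit false
set_option linter.dupNamespace false

noncomputable section

open scoped Classical

open WeierstrassCurve NumberField Literature.NumberTheory.EllipticCurves
  Literature.NumberTheory.EllipticCurves.Rank1Residual
  Literature.NumberTheory.EllipticCurves.Rank1Residual.Typed
  Literature.NumberTheory.EllipticCurves.HuShuYin2019
  Summit.BirchSwinnertonDyer.Rank1Residual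
  Summit.BirchSwinnertonDyer.BirchSwinnertonDyer.Theses.SylvesterTwoHeegnerIndex

namespace Summit.BirchSwinnertonDyer.BirchSwinnertonDyer.Theorems.SylvesterTwoUpper

/-! ## §0 The twin, and its content in Miller's currency -/

/-- **The twin unfolds by name**: `HeegnerIndexUpperAtTwoHSYOfFacts` is literally
`PublishedFactsTwo → HeegnerIndexUpperAtTwoHSY` (the route file spells the antecedent out because a
rank-2 item cannot forward-reference the rank-9 support decl). [folklore] -/
theorem upperOfFacts_iff :
    HeegnerIndexUpperAtTwoHSYOfFacts ↔ (PublishedFactsTwo → HeegnerIndexUpperAtTwoHSY) :=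
  Iff.rfl

/-- The lower twin likewise: `HeegnerIndexLowerAtTwoHSYOfFacts ↔ (PublishedFactsTwo →
HeegnerIndexLowerAtTwoHSY)`. [folklore] -/
theorem lowerOfFacts_iff :
    HeegnerIndexLowerAtTwoHSYOfFacts ↔ (PublishedFactsTwo → HeegnerIndexLowerAtTwoHSY) :=
  Iff.rfl

/-- **Content of the twin** (p418375 `heegnerIndexUpperAtTwoHSY_iff_missingUpperBoundAt`, moved
under the antecedent): the crux ⟺ granted the facts, every globally minimal model of every member of
𝒞_HSY satisfies the Euler-system half `MissingUpperBoundAt W 2`. [cite: Miller2011LMS, Def. 1.1]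
[cite: Kolyvagin1990, Thm. A] -/
theorem upperOfFacts_iff_missingUpperBoundAt :
    HeegnerIndexUpperAtTwoHSYOfFacts ↔
      (PublishedFactsTwo → ∀ (p : ℕ), p.Prime → (p % 9 = 4 ∨ p % 9 = 7) → (¬ ∃ x : ZMod p, x ^ 3 = 3) →
        ∀ (W : WeierstrassCurve ℚ) [W.IsElliptic] [W.IsGloballyMinimal],
          (∃ C : VariableChange ℚ, C • W = cubeSumCurve (p : ℚ)) → MissingUpperBoundAt W 2) := by
  rw [upperOfFacts_iff]
  exact ⟨fun h hF => (heegnerIndexUpperAtTwoHSY_iff_missingUpperBoundAt hF).mp (h hF),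
    fun h hF => (heegnerIndexUpperAtTwoHSY_iff_missingUpperBoundAt hF).mpr (h hF)⟩

/-! ## §1 The pair `(E_p, E_{3p²})`: the partner's terms cancel (Burungale–Flach), binder-free -/

section Pair

variable {p : ℕ}

/-- **The partner's bookkeeping.** For a globally minimal `A ≅ E_{3p²}` (with `B ≅ E_p` present, as
the family fact is stated for the pair): `r_an(A) = 0` (Hu–Shu–Yin), hence `L(A,1) ≠ 0` (modularity),
hence FULL BSD for the CM curve `A` (Burungale–Flach 2024 / Rubin: `bsdTriple_of_hasCM_of_L_one_ne_zero`),
so `#Ш_an(A) = qA ≠ 0` is rational with `ord₂ qA = ord₂ #Ш(A)[2^∞]`, `Ш(A)[2^∞]` finite; and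
`#Ш_an(B) = qB ≠ 0`, `Ш(B)` finite. [cite: HuShuYin2019, Thm. 1.3 and p. 4]
[cite: BurungaleFlach2024, Thm. 1.1 and Cor. 2] [cite: Miller2011LMS, Def. 1.1] -/
theorem pair_shaAn_two (hHSY : thm14_threePart_product)
    (hCM0 : bsdTriple_of_hasCM_of_L_one_ne_zero) (hmod : hasEntireLFunction_rat)
    (hp : p.Prime) (h9 : p % 9 = 4 ∨ p % 9 = 7) (h3 : ¬ ∃ x : ZMod p, x ^ 3 = 3)
    (A B : WeierstrassCurve ℚ) [A.IsElliptic] [A.IsGloballyMinimal] [B.IsElliptic]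
    [B.IsGloballyMinimal] (hB : ∃ C : VariableChange ℚ, C • B = cubeSumCurve (p : ℚ))
    (hA : ∃ C : VariableChange ℚ, C • A = cubeSumCurve (3 * (p : ℚ) ^ 2)) :
    Finite B.sha ∧ Finite (AddCommGroup.primaryComponent A.sha 2) ∧
      ∃ qB qA : ℚ, shaAn B = (qB : ℂ) ∧ shaAn A = (qA : ℂ) ∧ qB ≠ 0 ∧ qA ≠ 0 ∧
        padicValRat 2 qA = padicValNat 2 (Nat.card (AddCommGroup.primaryComponent A.sha 2)) := by
  obtain ⟨-, -, hfinB, -, hA0, -, -, -, qB, qA, hqB, hqA, hne, -⟩ := hHSY p hp h9 h3 A B hB hA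
  have hL : A.entireLFunction 1 ≠ 0 := (A.analyticRank_eq_zero_iff_holds (hmod A)).1 hA0
  have hT : A.BSDTriple := hCM0 A (hasCM_of_variableChange_eq hA) hL
  obtain ⟨-, hfinA, qA', hqA', hvA'⟩ := forall_bsdp_of_bsdTriple' A hT 2 Nat.prime_two
  have hqq : qA' = qA := by exact_mod_cast hqA'.symm.trans hqA
  subst hqq
  obtain ⟨hqB0, hqA0⟩ := mul_ne_zero_iff.mp hne
  exact ⟨hfinB, hfinA, qB, qA', hqB, hqA, hqB0, hqA0, hvA'⟩

/-- **UPPER half at a member ⟺ the `2`-adic Kolyvagin inequality for the PAIR.** For globally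
minimal `B ≅ E_p`, `A ≅ E_{3p²}` (`p` in 𝒞_HSY), granted Hu–Shu–Yin, Burungale–Flach and modularity:
`MissingUpperBoundAt B 2` (`ord₂ #Ш(B) ≤ ord₂ #Ш_an(B)`) holds iff
`ord₂ #Ш(B)[2^∞] + ord₂ #Ш(A)[2^∞] ≤ ord₂ (#Ш_an(B) · #Ш_an(A))` — the Euler-system inequality for
Hu–Shu–Yin's Rankin-type product `L′(1,E_p)·L(1,E_{3p²}) = 2^α·9·Ω_p Ω_{3p²}·ĥ(R)` (Cor. 4.4), the
partner's `ord₂ #Ш_an(A) = ord₂ #Ш(A)[2^∞]` cancelling exactly. [cite: HuShuYin2019, Cor. 4.4 and (bsd) p. 12]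
[cite: BurungaleFlach2024, Thm. 1.1 and Cor. 2] [cite: Miller2011LMS, Def. 1.1] -/
theorem missingUpperBoundAt_iff_pairBound (hHSY : thm14_threePart_product)
    (hCM0 : bsdTriple_of_hasCM_of_L_one_ne_zero) (hmod : hasEntireLFunction_rat)
    (hp : p.Prime) (h9 : p % 9 = 4 ∨ p % 9 = 7) (h3 : ¬ ∃ x : ZMod p, x ^ 3 = 3)
    (A B : WeierstrassCurve ℚ) [A.IsElliptic] [A.IsGloballyMinimal] [B.IsElliptic]
    [B.IsGloballyMinimal] (hB : ∃ C : VariableChange ℚ, C • B = cubeSumCurve (p : ℚ))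
    (hA : ∃ C : VariableChange ℚ, C • A = cubeSumCurve (3 * (p : ℚ) ^ 2)) :
    MissingUpperBoundAt B 2 ↔
      ∃ qB qA : ℚ, shaAn B = (qB : ℂ) ∧ shaAn A = (qA : ℂ) ∧ qB * qA ≠ 0 ∧
        (padicValNat 2 (Nat.card (AddCommGroup.primaryComponent B.sha 2)) : ℤ) +
            (padicValNat 2 (Nat.card (AddCommGroup.primaryComponent A.sha 2)) : ℤ) ≤
          padicValRat 2 (qB * qA) := by
  haveI : Fact (2 : ℕ).Prime := ⟨Nat.prime_two⟩
  obtain ⟨hfinB, -, qB, qA, hqB, hqA, hqB0, hqA0, hvA⟩ :=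
    pair_shaAn_two hHSY hCM0 hmod hp h9 h3 A B hB hA
  haveI : Finite B.sha := hfinB
  have hB2 : (padicValNat 2 B.shaOrder : ℤ) =
      padicValNat 2 (Nat.card (AddCommGroup.primaryComponent B.sha 2)) := by
    rw [WeierstrassCurve.shaOrder, ← padicValNat_card_addPrimaryComponent 2]
  constructor
  · rintro ⟨q, hq, hle⟩
    have hqq : q = qB := by exact_mod_cast hq.symm.trans hqB
    subst hqq
    refine ⟨q, qA, hq, hqA, mul_ne_zero hqB0 hqA0, ?_⟩
    rw [padicValRat.mul hqB0 hqA0, hvA, ← hB2]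
    linarith
  · rintro ⟨qB', qA', hqB', hqA', hne, hle⟩
    have hqq : qB' = qB := by exact_mod_cast hqB'.symm.trans hqB
    have hqq' : qA' = qA := by exact_mod_cast hqA'.symm.trans hqA
    subst hqq hqq'
    refine ⟨qB', hqB, ?_⟩
    rw [padicValRat.mul hqB0 hqA0, hvA, ← hB2] at hle
    linarith

/-- **LOWER half at a member ⟺ the reverse pair inequality** (for hand k7t-c3, item 19477):
`MissingLowerBoundAt B 2 ⟺ ord₂ (#Ш_an(B) · #Ш_an(A)) ≤ ord₂ #Ш(B)[2^∞] + ord₂ #Ш(A)[2^∞]` — the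
Gross–Zagier / main-conjecture direction for the pair. [cite: HuShuYin2019, Cor. 4.4 and (bsd) p. 12]
[cite: BurungaleFlach2024, Thm. 1.1 and Cor. 2] [cite: Miller2011LMS, Def. 1.1] -/
theorem missingLowerBoundAt_iff_pairBound (hHSY : thm14_threePart_product)
    (hCM0 : bsdTriple_of_hasCM_of_L_one_ne_zero) (hmod : hasEntireLFunction_rat)
    (hp : p.Prime) (h9 : p % 9 = 4 ∨ p % 9 = 7) (h3 : ¬ ∃ x : ZMod p, x ^ 3 = 3)
    (A B : WeierstrassCurve ℚ) [A.IsElliptic] [A.IsGloballyMinimal] [B.IsElliptic]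
    [B.IsGloballyMinimal] (hB : ∃ C : VariableChange ℚ, C • B = cubeSumCurve (p : ℚ))
    (hA : ∃ C : VariableChange ℚ, C • A = cubeSumCurve (3 * (p : ℚ) ^ 2)) :
    MissingLowerBoundAt B 2 ↔
      ∃ qB qA : ℚ, shaAn B = (qB : ℂ) ∧ shaAn A = (qA : ℂ) ∧ qB * qA ≠ 0 ∧
        padicValRat 2 (qB * qA) ≤
          (padicValNat 2 (Nat.card (AddCommGroup.primaryComponent B.sha 2)) : ℤ) +
            (padicValNat 2 (Nat.card (AddCommGroup.primaryComponent A.sha 2)) : ℤ) := by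
  haveI : Fact (2 : ℕ).Prime := ⟨Nat.prime_two⟩
  obtain ⟨hfinB, -, qB, qA, hqB, hqA, hqB0, hqA0, hvA⟩ :=
    pair_shaAn_two hHSY hCM0 hmod hp h9 h3 A B hB hA
  haveI : Finite B.sha := hfinB
  have hB2 : (padicValNat 2 B.shaOrder : ℤ) =
      padicValNat 2 (Nat.card (AddCommGroup.primaryComponent B.sha 2)) := by
    rw [WeierstrassCurve.shaOrder, ← padicValNat_card_addPrimaryComponent 2]
  constructor
  · rintro ⟨q, hq, hle⟩
    have hqq : q = qB := by exact_mod_cast hq.symm.trans hqB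
    subst hqq
    refine ⟨q, qA, hq, hqA, mul_ne_zero hqB0 hqA0, ?_⟩
    rw [padicValRat.mul hqB0 hqA0, hvA, ← hB2]
    linarith
  · rintro ⟨qB', qA', hqB', hqA', hne, hle⟩
    have hqq : qB' = qB := by exact_mod_cast hqB'.symm.trans hqB
    have hqq' : qA' = qA := by exact_mod_cast hqA'.symm.trans hqA
    subst hqq hqq'
    refine ⟨qB', hqB, ?_⟩
    rw [padicValRat.mul hqB0 hqA0, hvA, ← hB2] at hle
    linarith

end Pair

/-- **THE CRUX IN PAIR FORM (binder-free).** `HeegnerIndexUpperAtTwoHSYOfFacts` holds iff, granted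
`PublishedFactsTwo`, for every prime `p ≡ 4, 7 (mod 9)` with `3 ∉ 𝔽_p^{×3}` and all globally minimal
`B ≅ E_p`, `A ≅ E_{3p²}`: `ord₂ #Ш(B)[2^∞] + ord₂ #Ш(A)[2^∞] ≤ ord₂ (#Ш_an(B) · #Ш_an(A))`. (→: p418375 +
`missingUpperBoundAt_iff_pairBound`; ←: a globally minimal model of `E_{3p²}` exists, Silverman VIII.8.3.)
So the open content of item 19476 is EXACTLY a `2`-adic Kolyvagin inequality for Hu–Shu–Yin's pair, whose
right side is `i + ord₂ (ĥ(R)/ĥ(P))` by their Cor. 4.4. OPEN AS A CLASS; nothing asserted.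
[cite: HuShuYin2019, Cor. 4.4 and (bsd) p. 12] [cite: Kolyvagin1990, Thm. A]
[cite: BurungaleFlach2024, Thm. 1.1 and Cor. 2] [cite: SilvermanAEC2009, VIII.8 Cor. 8.3] -/
theorem upperOfFacts_iff_pairBound :
    HeegnerIndexUpperAtTwoHSYOfFacts ↔
      (PublishedFactsTwo → ∀ (p : ℕ), p.Prime → (p % 9 = 4 ∨ p % 9 = 7) → (¬ ∃ x : ZMod p, x ^ 3 = 3) →
        ∀ (A B : WeierstrassCurve ℚ) [A.IsElliptic] [A.IsGloballyMinimal] [B.IsElliptic]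
          [B.IsGloballyMinimal], (∃ C : VariableChange ℚ, C • B = cubeSumCurve (p : ℚ)) →
          (∃ C : VariableChange ℚ, C • A = cubeSumCurve (3 * (p : ℚ) ^ 2)) →
          ∃ qB qA : ℚ, shaAn B = (qB : ℂ) ∧ shaAn A = (qA : ℂ) ∧ qB * qA ≠ 0 ∧
            (padicValNat 2 (Nat.card (AddCommGroup.primaryComponent B.sha 2)) : ℤ) +
                (padicValNat 2 (Nat.card (AddCommGroup.primaryComponent A.sha 2)) : ℤ) ≤
              padicValRat 2 (qB * qA)) := by
  rw [upperOfFacts_iff_missingUpperBoundAt]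
  refine ⟨fun h hF p hp h9 h3 A B _ _ _ _ hB hA => ?_, fun h hF p hp h9 h3 B _ _ hB => ?_⟩
  · have hF' := hF
    obtain ⟨hHSY, hCM0, hmod, -⟩ := hF'
    exact (missingUpperBoundAt_iff_pairBound hHSY hCM0 hmod hp h9 h3 A B hB hA).mp
      (h hF p hp h9 h3 B hB)
  · have hF' := hF
    obtain ⟨hHSY, hCM0, hmod, -⟩ := hF'
    have hn : (3 * (p : ℚ) ^ 2) ≠ 0 :=
      mul_ne_zero (by norm_num) (pow_ne_zero _ (Nat.cast_ne_zero.mpr hp.ne_zero))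
    haveI := X12.CubeSumFamilies.isElliptic_cubeSumCurve hn
    obtain ⟨A, _, _, CA, hCA⟩ :=
      X12.CubeSumFamilies.exists_isGloballyMinimal_model (cubeSumCurve (3 * (p : ℚ) ^ 2))
    exact (missingUpperBoundAt_iff_pairBound hHSY hCM0 hmod hp h9 h3 A B hB ⟨CA, hCA⟩).mpr
      (h hF p hp h9 h3 A B hB ⟨CA, hCA⟩)

/-- **THE LOWER TWIN IN PAIR FORM (binder-free; for item 19477).** `HeegnerIndexLowerAtTwoHSYOfFacts`
holds iff, granted `PublishedFactsTwo`, for all members and partners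
`ord₂ (#Ш_an(B) · #Ш_an(A)) ≤ ord₂ #Ш(B)[2^∞] + ord₂ #Ш(A)[2^∞]` (p417655
`heegnerIndexLowerAtTwoHSY_iff_missingLowerBoundAt_onFamily` + `missingLowerBoundAt_iff_pairBound`).
[cite: HuShuYin2019, Cor. 4.4 and (bsd) p. 12] [cite: GrossZagier1986, I.(6.5) and V.§2]
[cite: BurungaleFlach2024, Thm. 1.1 and Cor. 2] [cite: SilvermanAEC2009, VIII.8 Cor. 8.3] -/
theorem lowerOfFacts_iff_pairBound :
    HeegnerIndexLowerAtTwoHSYOfFacts ↔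
      (PublishedFactsTwo → ∀ (p : ℕ), p.Prime → (p % 9 = 4 ∨ p % 9 = 7) → (¬ ∃ x : ZMod p, x ^ 3 = 3) →
        ∀ (A B : WeierstrassCurve ℚ) [A.IsElliptic] [A.IsGloballyMinimal] [B.IsElliptic]
          [B.IsGloballyMinimal], (∃ C : VariableChange ℚ, C • B = cubeSumCurve (p : ℚ)) →
          (∃ C : VariableChange ℚ, C • A = cubeSumCurve (3 * (p : ℚ) ^ 2)) →
          ∃ qB qA : ℚ, shaAn B = (qB : ℂ) ∧ shaAn A = (qA : ℂ) ∧ qB * qA ≠ 0 ∧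
            padicValRat 2 (qB * qA) ≤
              (padicValNat 2 (Nat.card (AddCommGroup.primaryComponent B.sha 2)) : ℤ) +
                (padicValNat 2 (Nat.card (AddCommGroup.primaryComponent A.sha 2)) : ℤ)) := by
  rw [lowerOfFacts_iff]
  refine ⟨fun h hF p hp h9 h3 A B _ _ _ _ hB hA => ?_, fun h hF => ?_⟩
  · have hlo := (SylvesterTwoLower.heegnerIndexLowerAtTwoHSY_iff_missingLowerBoundAt_onFamily hF).mp
      (h hF) p hp h9 h3 B hB
    obtain ⟨hHSY, hCM0, hmod, -⟩ := hF
    exact (missingLowerBoundAt_iff_pairBound hHSY hCM0 hmod hp h9 h3 A B hB hA).mp hlo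
  · refine (SylvesterTwoLower.heegnerIndexLowerAtTwoHSY_iff_missingLowerBoundAt_onFamily hF).mpr
      fun p hp h9 h3 B _ _ hB => ?_
    have hF' := hF
    obtain ⟨hHSY, hCM0, hmod, -⟩ := hF'
    have hn : (3 * (p : ℚ) ^ 2) ≠ 0 :=
      mul_ne_zero (by norm_num) (pow_ne_zero _ (Nat.cast_ne_zero.mpr hp.ne_zero))
    haveI := X12.CubeSumFamilies.isElliptic_cubeSumCurve hn
    obtain ⟨A, _, _, CA, hCA⟩ :=
      X12.CubeSumFamilies.exists_isGloballyMinimal_model (cubeSumCurve (3 * (p : ℚ) ^ 2))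
    exact (missingLowerBoundAt_iff_pairBound hHSY hCM0 hmod hp h9 h3 A B hB ⟨CA, hCA⟩).mpr
      (h hF p hp h9 h3 A B hB ⟨CA, hCA⟩)

end Summit.BirchSwinnertonDyer.BirchSwinnertonDyer.Theorems.SylvesterTwoUpper

end
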